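import Summits.Parity.BatemanHorn.Theorems.RoughValueTransportBalancedSemiprimeLayerDegreeLeTwo
import Summits.Parity.BatemanHorn.Theorems.RoughValueTransportBalancedSemiprimeLayerRoughWindowLever
import Summits.Parity.BatemanHorn.Theorems.RoughValueTransportBalancedSemiprimeLayerRootLevelTransfer
import HarnessLib

/-!
# Route `RoughValueTransport`, crux `BalancedSemiprimeLayer` (stmt-Parity-9469): the crux from the
# single-polynomial root-level statement (line `rough-relaxed-divisor-sieve`, seat c2, stub S10)

The composition of the registered skeleton `Cruxes/BalancedSemiprimeLayer/Lines/rough_relaxed_divisor_sieve_c2.lean`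
as a TREE theorem: `BalancedSemiprimeLayer` follows from the single-polynomial root-level statement
(S8 `stub_roughWindowRootLevel_highDegree`, OPEN — the crux's residual for coordinates of degree `≥ 3`)
by LANDED theorems only —

* `stub_rootLevelTransfer` (p125151): single-polynomial root level for `g = fᵢ` ⟹ `RoughWindowTypeI f i`;
* `stub_roughWindowLever` (p107548): `RoughWindowTypeI f i` ⟹ `CoordLayerThin f i` (k-dimensional sieve on
  the rough balanced-divisor line, Mertens for `ρᵢ` in upper-bound form);
* `stub_transfer` (p78616): `CoordLayerThin` for every coordinate of degree `≥ 3` ⟹ the crux (glue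
  `Φ_f ≤ P_f + Σᵢ Eᵢ`, least `δ`, `k = 0` slice, and degrees `≤ 2` by the landed line
  `smooth-modulus-twisted-hooley`).

So the moment the hypothesis of `stub_cruxOfRootLevel` is a theorem `T`, the crux closes `--by` the
one-liner `stub_cruxOfRootLevel T`; the same for the system Type-I form (`balancedSemiprimeLayer_of_roughWindowTypeI`).
Nothing is asserted here beyond these implications; the hypothesis is displayed, not named, so that the
planner can file it verbatim as a statement item.

References: the line card `Cruxes/BalancedSemiprimeLayer/Lines/rough_relaxed_divisor_sieve_c1.md` and the
dead-line file `Lines/rough-relaxed-divisor-sieve-dead-c2.md` (why the hypothesis is open: root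
equidistribution modulo `m ≍ x^{d/2} > x` with power saving; Hooley, Mathematika 11 (1964) gives
log-savings only; Heath-Brown, Proc. LMS 82 (2001) / Ermoshin arXiv:2602.03642 reach level `x^{1.006}`).
-/

noncomputable section

open Polynomial Filter Finset
open Literature.NumberTheory.Sieve

namespace Summit.Parity.BatemanHorn.Cruxes.BalancedSemiprimeLayer.RoughRelaxedDivisorSieve

open Summit.Parity.BatemanHorn.Theses.RoughValueTransport (BalancedSemiprimeLayer)
open Summit.Parity.BatemanHorn.Cruxes.BalancedSemiprimeLayer.SmoothModulusTwistedHooley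
  (CoordLayerThin stub_transfer)

/-- **The crux from the system Type-I form of the residual** (S7): if every coordinate of degree `≥ 3`
of every Bateman–Horn system has `RoughWindowTypeI`, then `BalancedSemiprimeLayer` (LANDED lever p107548 +
LANDED transfer p78616). [folklore] -/
theorem balancedSemiprimeLayer_of_roughWindowTypeI
    (h7 : ∀ (k : ℕ) (f : Fin k → ℤ[X]), IsBatemanHornSystem f → ∀ i : Fin k,
      3 ≤ (f i).natDegree → RoughWindowTypeI f i) :
    BalancedSemiprimeLayer :=
  stub_transfer fun k f hf i hi => stub_roughWindowLever k f hf i (h7 k f hf i hi)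

/-- **S10 `stub_cruxOfRootLevel`** (registered transfer stub of skeleton r4.2, seat c2): the crux
`BalancedSemiprimeLayer` from the SINGLE-POLYNOMIAL root-level statement for irreducible polynomials of
degree `≥ 3` with positive leading coefficient (the displayed hypothesis = stub S8 verbatim), through
`stub_rootLevelTransfer` (p125151), `stub_roughWindowLever` (p107548) and `stub_transfer` (p78616). [folklore] -/
theorem stub_cruxOfRootLevel :
    (∀ g : ℤ[X], Irreducible g → 0 < g.leadingCoeff → 3 ≤ g.natDegree →
      ∃ c₀ : ℝ, 0 < c₀ ∧ ∀ c : ℝ, 0 < c → c ≤ c₀ → ∀ δ : ℝ, 0 < δ → δ ≤ c →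
        ∃ η : ℝ, 0 < η ∧ ∀ᶠ x : ℕ in Filter.atTop,
          (∑ e ∈ (Finset.Icc 1 ⌊(x : ℝ) ^ c⌋₊).filter Squarefree, ∑ s ∈ Finset.range e,
            |∑ m ∈ roughDivWindow g.natDegree δ c x,
              ((#((Finset.Ioc 0 x).filter fun n : ℕ =>
                  n ≡ s [MOD e] ∧ (m : ℤ) ∣ g.eval (n : ℤ)) : ℝ) -
                (x : ℝ) / e * ((polyRootCountMod ![g] m : ℝ) / m))|) ≤ (x : ℝ) ^ (1 - η)) →
      BalancedSemiprimeLayer :=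
  fun h8 => balancedSemiprimeLayer_of_roughWindowTypeI fun k f hf i hi =>
    stub_rootLevelTransfer k f hf i ((Nat.le_succ 2).trans hi)
      (h8 (f i) (hf.irreducible i) (hf.leadingCoeff_pos i) hi)

end Summit.Parity.BatemanHorn.Cruxes.BalancedSemiprimeLayer.RoughRelaxedDivisorSieve
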